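import Mathlib
import Summits.Ventures.PercRepro2.Defs
import Summits.Ventures.PercRepro2.Harris
import Summits.Ventures.PercRepro2.CoinDefs
import Summits.Ventures.PercRepro2.CoinReverse
import Summits.Ventures.PercRepro2.CoinStarDefs
import Summits.Ventures.PercRepro2.CoinLsmCoreDefs
import Summits.Ventures.PercRepro2.CoinLsmCoreU
import Summits.Ventures.PercRepro2.CoinSquareCoreDefs
import Summits.Ventures.PercRepro2.CoinSquareCore
import Summits.Ventures.PercRepro2.CoinCoreGate
import Summits.Ventures.PercRepro2.CoinDiamondAlg
import Summits.Ventures.PercRepro2.CoinDiamondCoreDefs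

/-!
# Row 2′DARC at the OR-TAIL of the DIRECTED diamond at every head (blind cell PercRepro2,
night-2 g8; proofs/NIGHT2-DARC.md §32)

`darc_of_diamondCore`: on a mixed coin system whose closed-in core is the directed diamond
`s → p → a ← q ← s` (four single-arc coins, nothing else entering `{s, p, q, a}`), with the tail
`u = a` and the markers `p, q`, row 2′DARC holds at the arc `a → w` for EVERY head — the core where
the cell split of `star_alg` FAILS (the `u`-cell bracket is negative already for the trivial head):
the whole cleared functional is certified at once by `diamond_cert` (the 272-term combination of
eleven log-supermodular and eight monotonicity steps of the head values), through the core sums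
of `ClosedInCoreU.phiC_gate_eq` and the level polynomials of `CoinDiamondCoreDefs.lean`.
-/

namespace Summit.Ventures.PercRepro2.Coin

open Classical

section DiamondMain

variable {V : Type*} {E : Type*} [Fintype V] [DecidableEq V] [Fintype E] [DecidableEq E]
  {R : Type*} [Field R] [LinearOrder R] [IsStrictOrderedRing R]
  {arcs : E → Finset (V × V)} {s p q a w : V} {c₁ c₂ c₃ c₄ : E}

omit [Fintype V] [Fintype E] [DecidableEq E] [IsStrictOrderedRing R] in
/-- Step `1` of the diamond certificate (log-supermodular). -/
lemma diamond_step1 (A : Finset V → R)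
    (hl : ∀ X Y Z U : Finset V, X ∩ Y = Z → X ∪ Y = U → A X * A Y ≤ A Z * A U)
    (h : DiamondCore arcs s p q a c₁ c₂ c₃ c₄) (hwC : w ∉ ({p, q, a} : Finset V)) :
    A {p, a} * A (insert w {q, a}) ≤ A {a} * A (insert w {p, q, a}) := by
  have hpq := h.pq
  have hpa := h.pa
  have hqa := h.qa
  have hqp : q ≠ p := h.pq.symm
  have hap : a ≠ p := h.pa.symm
  have haq : a ≠ q := h.qa.symm
  have hwp : w ≠ p := fun e => hwC (by simp [e])
  have hwq : w ≠ q := fun e => hwC (by simp [e])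
  have hwa : w ≠ a := fun e => hwC (by simp [e])
  refine hl _ _ _ _ ?_ ?_
  · ext x; simp only [Finset.mem_inter, Finset.mem_insert, Finset.mem_singleton]; aesop
  · ext x; simp only [Finset.mem_union, Finset.mem_insert, Finset.mem_singleton]; aesop

omit [Fintype V] [Fintype E] [DecidableEq E] [IsStrictOrderedRing R] in
/-- Step `2` of the diamond certificate (log-supermodular). -/
lemma diamond_step2 (A : Finset V → R)
    (hl : ∀ X Y Z U : Finset V, X ∩ Y = Z → X ∪ Y = U → A X * A Y ≤ A Z * A U)
    (h : DiamondCore arcs s p q a c₁ c₂ c₃ c₄) (hwC : w ∉ ({p, q, a} : Finset V)) :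
    A {p, q, a} * A (insert w {p, a}) ≤ A {p, a} * A (insert w {p, q, a}) := by
  have hpq := h.pq
  have hpa := h.pa
  have hqa := h.qa
  have hqp : q ≠ p := h.pq.symm
  have hap : a ≠ p := h.pa.symm
  have haq : a ≠ q := h.qa.symm
  have hwp : w ≠ p := fun e => hwC (by simp [e])
  have hwq : w ≠ q := fun e => hwC (by simp [e])
  have hwa : w ≠ a := fun e => hwC (by simp [e])
  refine hl _ _ _ _ ?_ ?_
  · ext x; simp only [Finset.mem_inter, Finset.mem_insert, Finset.mem_singleton]; aesop
  · ext x; simp only [Finset.mem_union, Finset.mem_insert, Finset.mem_singleton]; aesop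

omit [Fintype V] [Fintype E] [DecidableEq E] [IsStrictOrderedRing R] in
/-- Step `3` of the diamond certificate (log-supermodular). -/
lemma diamond_step3 (A : Finset V → R)
    (hl : ∀ X Y Z U : Finset V, X ∩ Y = Z → X ∪ Y = U → A X * A Y ≤ A Z * A U)
    (h : DiamondCore arcs s p q a c₁ c₂ c₃ c₄) (hwC : w ∉ ({p, q, a} : Finset V)) :
    A {p, q, a} * A (insert w {q, a}) ≤ A {q, a} * A (insert w {p, q, a}) := by
  have hpq := h.pq
  have hpa := h.pa
  have hqa := h.qa
  have hqp : q ≠ p := h.pq.symm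
  have hap : a ≠ p := h.pa.symm
  have haq : a ≠ q := h.qa.symm
  have hwp : w ≠ p := fun e => hwC (by simp [e])
  have hwq : w ≠ q := fun e => hwC (by simp [e])
  have hwa : w ≠ a := fun e => hwC (by simp [e])
  refine hl _ _ _ _ ?_ ?_
  · ext x; simp only [Finset.mem_inter, Finset.mem_insert, Finset.mem_singleton]; aesop
  · ext x; simp only [Finset.mem_union, Finset.mem_insert, Finset.mem_singleton]; aesop

omit [Fintype V] [Fintype E] [DecidableEq E] [IsStrictOrderedRing R] in
/-- Step `4` of the diamond certificate (log-supermodular). -/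
lemma diamond_step4 (A : Finset V → R)
    (hl : ∀ X Y Z U : Finset V, X ∩ Y = Z → X ∪ Y = U → A X * A Y ≤ A Z * A U)
    (h : DiamondCore arcs s p q a c₁ c₂ c₃ c₄) (hwC : w ∉ ({p, q, a} : Finset V)) :
    A {q, a} * A (insert w {p, a}) ≤ A {a} * A (insert w {p, q, a}) := by
  have hpq := h.pq
  have hpa := h.pa
  have hqa := h.qa
  have hqp : q ≠ p := h.pq.symm
  have hap : a ≠ p := h.pa.symm
  have haq : a ≠ q := h.qa.symm
  have hwp : w ≠ p := fun e => hwC (by simp [e])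
  have hwq : w ≠ q := fun e => hwC (by simp [e])
  have hwa : w ≠ a := fun e => hwC (by simp [e])
  refine hl _ _ _ _ ?_ ?_
  · ext x; simp only [Finset.mem_inter, Finset.mem_insert, Finset.mem_singleton]; aesop
  · ext x; simp only [Finset.mem_union, Finset.mem_insert, Finset.mem_singleton]; aesop

omit [Fintype V] [Fintype E] [DecidableEq E] [IsStrictOrderedRing R] in
/-- Step `5` of the diamond certificate (log-supermodular). -/
lemma diamond_step5 (A : Finset V → R)
    (hl : ∀ X Y Z U : Finset V, X ∩ Y = Z → X ∪ Y = U → A X * A Y ≤ A Z * A U)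
    (h : DiamondCore arcs s p q a c₁ c₂ c₃ c₄) (hwC : w ∉ ({p, q, a} : Finset V)) :
    A {p} * A {q, a} ≤ A ∅ * A {p, q, a} := by
  have hpq := h.pq
  have hpa := h.pa
  have hqa := h.qa
  have hqp : q ≠ p := h.pq.symm
  have hap : a ≠ p := h.pa.symm
  have haq : a ≠ q := h.qa.symm
  have hwp : w ≠ p := fun e => hwC (by simp [e])
  have hwq : w ≠ q := fun e => hwC (by simp [e])
  have hwa : w ≠ a := fun e => hwC (by simp [e])
  refine hl _ _ _ _ ?_ ?_
  · ext x; simp only [Finset.mem_inter, Finset.mem_insert, Finset.mem_singleton, Finset.notMem_empty]; aesop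
  · ext x; simp only [Finset.mem_union, Finset.mem_insert, Finset.mem_singleton]

omit [Fintype V] [Fintype E] [DecidableEq E] [IsStrictOrderedRing R] in
/-- Step `6` of the diamond certificate (log-supermodular). -/
lemma diamond_step6 (A : Finset V → R)
    (hl : ∀ X Y Z U : Finset V, X ∩ Y = Z → X ∪ Y = U → A X * A Y ≤ A Z * A U)
    (h : DiamondCore arcs s p q a c₁ c₂ c₃ c₄) (hwC : w ∉ ({p, q, a} : Finset V)) :
    A {p} * A (insert w {q, a}) ≤ A ∅ * A (insert w {p, q, a}) := by
  have hpq := h.pq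
  have hpa := h.pa
  have hqa := h.qa
  have hqp : q ≠ p := h.pq.symm
  have hap : a ≠ p := h.pa.symm
  have haq : a ≠ q := h.qa.symm
  have hwp : w ≠ p := fun e => hwC (by simp [e])
  have hwq : w ≠ q := fun e => hwC (by simp [e])
  have hwa : w ≠ a := fun e => hwC (by simp [e])
  refine hl _ _ _ _ ?_ ?_
  · ext x; simp only [Finset.mem_inter, Finset.mem_insert, Finset.mem_singleton, Finset.notMem_empty]; aesop
  · ext x; simp only [Finset.mem_union, Finset.mem_insert, Finset.mem_singleton]; aesop

omit [Fintype V] [Fintype E] [DecidableEq E] [IsStrictOrderedRing R] in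
/-- Step `7` of the diamond certificate (log-supermodular). -/
lemma diamond_step7 (A : Finset V → R)
    (hl : ∀ X Y Z U : Finset V, X ∩ Y = Z → X ∪ Y = U → A X * A Y ≤ A Z * A U)
    (h : DiamondCore arcs s p q a c₁ c₂ c₃ c₄) (hwC : w ∉ ({p, q, a} : Finset V)) :
    A {p} * A {q} ≤ A ∅ * A {p, q} := by
  have hpq := h.pq
  have hpa := h.pa
  have hqa := h.qa
  have hqp : q ≠ p := h.pq.symm
  have hap : a ≠ p := h.pa.symm
  have haq : a ≠ q := h.qa.symm
  have hwp : w ≠ p := fun e => hwC (by simp [e])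
  have hwq : w ≠ q := fun e => hwC (by simp [e])
  have hwa : w ≠ a := fun e => hwC (by simp [e])
  refine hl _ _ _ _ ?_ ?_
  · ext x; simp only [Finset.mem_inter, Finset.mem_singleton, Finset.notMem_empty]; aesop
  · ext x; simp only [Finset.mem_union, Finset.mem_insert, Finset.mem_singleton]

omit [Fintype V] [Fintype E] [DecidableEq E] [IsStrictOrderedRing R] in
/-- Step `8` of the diamond certificate (log-supermodular). -/
lemma diamond_step8 (A : Finset V → R)
    (hl : ∀ X Y Z U : Finset V, X ∩ Y = Z → X ∪ Y = U → A X * A Y ≤ A Z * A U)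
    (h : DiamondCore arcs s p q a c₁ c₂ c₃ c₄) (hwC : w ∉ ({p, q, a} : Finset V)) :
    A {p, q} * A (insert w {p, a}) ≤ A {p} * A (insert w {p, q, a}) := by
  have hpq := h.pq
  have hpa := h.pa
  have hqa := h.qa
  have hqp : q ≠ p := h.pq.symm
  have hap : a ≠ p := h.pa.symm
  have haq : a ≠ q := h.qa.symm
  have hwp : w ≠ p := fun e => hwC (by simp [e])
  have hwq : w ≠ q := fun e => hwC (by simp [e])
  have hwa : w ≠ a := fun e => hwC (by simp [e])
  refine hl _ _ _ _ ?_ ?_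
  · ext x; simp only [Finset.mem_inter, Finset.mem_insert, Finset.mem_singleton]; aesop
  · ext x; simp only [Finset.mem_union, Finset.mem_insert, Finset.mem_singleton]; aesop

omit [Fintype V] [Fintype E] [DecidableEq E] [IsStrictOrderedRing R] in
/-- Step `9` of the diamond certificate (log-supermodular). -/
lemma diamond_step9 (A : Finset V → R)
    (hl : ∀ X Y Z U : Finset V, X ∩ Y = Z → X ∪ Y = U → A X * A Y ≤ A Z * A U)
    (h : DiamondCore arcs s p q a c₁ c₂ c₃ c₄) (hwC : w ∉ ({p, q, a} : Finset V)) :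
    A {p, q} * A (insert w {q, a}) ≤ A {q} * A (insert w {p, q, a}) := by
  have hpq := h.pq
  have hpa := h.pa
  have hqa := h.qa
  have hqp : q ≠ p := h.pq.symm
  have hap : a ≠ p := h.pa.symm
  have haq : a ≠ q := h.qa.symm
  have hwp : w ≠ p := fun e => hwC (by simp [e])
  have hwq : w ≠ q := fun e => hwC (by simp [e])
  have hwa : w ≠ a := fun e => hwC (by simp [e])
  refine hl _ _ _ _ ?_ ?_
  · ext x; simp only [Finset.mem_inter, Finset.mem_insert, Finset.mem_singleton]; aesop
  · ext x; simp only [Finset.mem_union, Finset.mem_insert, Finset.mem_singleton]; aesop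

omit [Fintype V] [Fintype E] [DecidableEq E] [IsStrictOrderedRing R] in
/-- Step `10` of the diamond certificate (log-supermodular). -/
lemma diamond_step10 (A : Finset V → R)
    (hl : ∀ X Y Z U : Finset V, X ∩ Y = Z → X ∪ Y = U → A X * A Y ≤ A Z * A U)
    (h : DiamondCore arcs s p q a c₁ c₂ c₃ c₄) (hwC : w ∉ ({p, q, a} : Finset V)) :
    A {q} * A {p, a} ≤ A ∅ * A {p, q, a} := by
  have hpq := h.pq
  have hpa := h.pa
  have hqa := h.qa
  have hqp : q ≠ p := h.pq.symm
  have hap : a ≠ p := h.pa.symm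
  have haq : a ≠ q := h.qa.symm
  have hwp : w ≠ p := fun e => hwC (by simp [e])
  have hwq : w ≠ q := fun e => hwC (by simp [e])
  have hwa : w ≠ a := fun e => hwC (by simp [e])
  refine hl _ _ _ _ ?_ ?_
  · ext x; simp only [Finset.mem_inter, Finset.mem_insert, Finset.mem_singleton, Finset.notMem_empty]; aesop
  · ext x; simp only [Finset.mem_union, Finset.mem_insert, Finset.mem_singleton]; aesop

omit [Fintype V] [Fintype E] [DecidableEq E] [IsStrictOrderedRing R] in
/-- Step `11` of the diamond certificate (log-supermodular). -/
lemma diamond_step11 (A : Finset V → R)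
    (hl : ∀ X Y Z U : Finset V, X ∩ Y = Z → X ∪ Y = U → A X * A Y ≤ A Z * A U)
    (h : DiamondCore arcs s p q a c₁ c₂ c₃ c₄) (hwC : w ∉ ({p, q, a} : Finset V)) :
    A {q} * A (insert w {p, a}) ≤ A ∅ * A (insert w {p, q, a}) := by
  have hpq := h.pq
  have hpa := h.pa
  have hqa := h.qa
  have hqp : q ≠ p := h.pq.symm
  have hap : a ≠ p := h.pa.symm
  have haq : a ≠ q := h.qa.symm
  have hwp : w ≠ p := fun e => hwC (by simp [e])
  have hwq : w ≠ q := fun e => hwC (by simp [e])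
  have hwa : w ≠ a := fun e => hwC (by simp [e])
  refine hl _ _ _ _ ?_ ?_
  · ext x; simp only [Finset.mem_inter, Finset.mem_insert, Finset.mem_singleton, Finset.notMem_empty]; aesop
  · ext x; simp only [Finset.mem_union, Finset.mem_insert, Finset.mem_singleton]; aesop

omit [Fintype V] [Fintype E] [DecidableEq E] [Field R] [IsStrictOrderedRing R] in
/-- Step `12` of the diamond certificate (monotone). -/
lemma diamond_step12 (A : Finset V → R)
    (hAmono : ∀ X Y : Finset V, X ⊆ Y → A Y ≤ A X) :
    A (insert w {p, a}) ≤ A {p, a} := by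
  exact hAmono _ _ (by simp)

omit [Fintype V] [Fintype E] [DecidableEq E] [Field R] [IsStrictOrderedRing R] in
/-- Step `13` of the diamond certificate (monotone). -/
lemma diamond_step13 (A : Finset V → R)
    (hAmono : ∀ X Y : Finset V, X ⊆ Y → A Y ≤ A X) :
    A (insert w {q, a}) ≤ A {q, a} := by
  exact hAmono _ _ (by simp)

omit [Fintype V] [DecidableEq V] [Fintype E] [DecidableEq E] [Field R] [IsStrictOrderedRing R] in
/-- Step `14` of the diamond certificate (monotone). -/
lemma diamond_step14 (A : Finset V → R)
    (hAmono : ∀ X Y : Finset V, X ⊆ Y → A Y ≤ A X) :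
    A {a} ≤ A ∅ := by
  exact hAmono _ _ (by simp)

omit [Fintype V] [Fintype E] [DecidableEq E] [Field R] [IsStrictOrderedRing R] in
/-- Step `15` of the diamond certificate (monotone). -/
lemma diamond_step15 (A : Finset V → R)
    (hAmono : ∀ X Y : Finset V, X ⊆ Y → A Y ≤ A X) :
    A {p, a} ≤ A {p} := by
  exact hAmono _ _ (by simp)

omit [Fintype V] [Fintype E] [DecidableEq E] [Field R] [IsStrictOrderedRing R] in
/-- Step `16` of the diamond certificate (monotone). -/
lemma diamond_step16 (A : Finset V → R)
    (hAmono : ∀ X Y : Finset V, X ⊆ Y → A Y ≤ A X) :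
    A (insert w {p, a}) ≤ A {p} := by
  exact hAmono _ _ (by simp)

omit [Fintype V] [Fintype E] [DecidableEq E] [Field R] [IsStrictOrderedRing R] in
/-- Step `17` of the diamond certificate (monotone). -/
lemma diamond_step17 (A : Finset V → R)
    (hAmono : ∀ X Y : Finset V, X ⊆ Y → A Y ≤ A X) :
    A {p, q, a} ≤ A {p, q} := by
  exact hAmono _ _ (by simp)

omit [Fintype V] [Fintype E] [DecidableEq E] [Field R] [IsStrictOrderedRing R] in
/-- Step `18` of the diamond certificate (monotone). -/
lemma diamond_step18 (A : Finset V → R)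
    (hAmono : ∀ X Y : Finset V, X ⊆ Y → A Y ≤ A X) :
    A {q, a} ≤ A {q} := by
  exact hAmono _ _ (by simp)

omit [Fintype V] [Fintype E] [DecidableEq E] [Field R] [IsStrictOrderedRing R] in
/-- Step `19` of the diamond certificate (monotone). -/
lemma diamond_step19 (A : Finset V → R)
    (hAmono : ∀ X Y : Finset V, X ⊆ Y → A Y ≤ A X) :
    A (insert w {q, a}) ≤ A {q} := by
  exact hAmono _ _ (by simp)

omit [Fintype V] [LinearOrder R] [IsStrictOrderedRing R] in
/-- The core sums of the diamond (tail `a`, markers `p, q`) expanded: `ν({a}) = 0`, the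
`starTarget` is `W ∪ {w}` on the three `a`-clusters, the level polynomials substituted. -/
theorem DiamondCore.phi_sums_eq (h : DiamondCore arcs s p q a c₁ c₂ c₃ c₄) (pr : E → R)
    (h12 : c₁ ≠ c₂) (h13 : c₁ ≠ c₃) (h14 : c₁ ≠ c₄) (h23 : c₂ ≠ c₃) (h24 : c₂ ≠ c₄) (h34 : c₃ ≠ c₄)
    (t : V) :
    (∑ W ∈ ({p, q, a} : Finset V).powerset, prob pr (coreLevel arcs s {p, q, a} W) * prob pr (coreAvoidEvent arcs s t {p, q, a} W)) ^ 2 * (∑ W ∈ ({p, q, a} : Finset V).powerset, prob pr (coreLevel arcs s {p, q, a} W) * prob pr (coreAvoidEvent arcs s t {p, q, a} (starTarget a w W)) * ((if p ∈ W then (1 : R) else 0) * (if q ∈ W then (1 : R) else 0)))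
        - (∑ W ∈ ({p, q, a} : Finset V).powerset, prob pr (coreLevel arcs s {p, q, a} W) * prob pr (coreAvoidEvent arcs s t {p, q, a} W)) * (∑ W ∈ ({p, q, a} : Finset V).powerset, prob pr (coreLevel arcs s {p, q, a} W) * prob pr (coreAvoidEvent arcs s t {p, q, a} W) * (if p ∈ W then (1 : R) else 0)) * (∑ W ∈ ({p, q, a} : Finset V).powerset, prob pr (coreLevel arcs s {p, q, a} W) * prob pr (coreAvoidEvent arcs s t {p, q, a} (starTarget a w W)) * (if q ∈ W then (1 : R) else 0))
        - (∑ W ∈ ({p, q, a} : Finset V).powerset, prob pr (coreLevel arcs s {p, q, a} W) * prob pr (coreAvoidEvent arcs s t {p, q, a} W)) * (∑ W ∈ ({p, q, a} : Finset V).powerset, prob pr (coreLevel arcs s {p, q, a} W) * prob pr (coreAvoidEvent arcs s t {p, q, a} W) * (if q ∈ W then (1 : R) else 0)) * (∑ W ∈ ({p, q, a} : Finset V).powerset, prob pr (coreLevel arcs s {p, q, a} W) * prob pr (coreAvoidEvent arcs s t {p, q, a} (starTarget a w W)) * (if p ∈ W then (1 : R) else 0))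
        + (∑ W ∈ ({p, q, a} : Finset V).powerset, prob pr (coreLevel arcs s {p, q, a} W) * prob pr (coreAvoidEvent arcs s t {p, q, a} W) * (if p ∈ W then (1 : R) else 0)) * (∑ W ∈ ({p, q, a} : Finset V).powerset, prob pr (coreLevel arcs s {p, q, a} W) * prob pr (coreAvoidEvent arcs s t {p, q, a} W) * (if q ∈ W then (1 : R) else 0)) * (∑ W ∈ ({p, q, a} : Finset V).powerset, prob pr (coreLevel arcs s {p, q, a} W) * prob pr (coreAvoidEvent arcs s t {p, q, a} (starTarget a w W)))
    = (((1 - pr c₁) * (1 - pr c₂) * ((pr c₃) + (1 - pr c₃)) * ((pr c₄) + (1 - pr c₄))) * prob pr (coreAvoidEvent arcs s t {p, q, a} ∅) + ((pr c₁) * (1 - pr c₂) * (1 - pr c₃) * ((pr c₄) + (1 - pr c₄))) * prob pr (coreAvoidEvent arcs s t {p, q, a} {p}) + ((1 - pr c₁) * (pr c₂) * (1 - pr c₄) * ((pr c₃) + (1 - pr c₃))) * prob pr (coreAvoidEvent arcs s t {p, q, a} {q}) + ((pr c₁) * (pr c₂) * (1 - pr c₃) * (1 - pr c₄)) * prob pr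 (coreAvoidEvent arcs s t {p, q, a} {p, q}) + ((pr c₁) * (1 - pr c₂) * (pr c₃) * ((pr c₄) + (1 - pr c₄))) * prob pr (coreAvoidEvent arcs s t {p, q, a} {p, a}) + ((1 - pr c₁) * (pr c₂) * (pr c₄) * ((pr c₃) + (1 - pr c₃))) * prob pr (coreAvoidEvent arcs s t {p, q, a} {q, a}) + ((pr c₁) * (pr c₂) * ((pr c₃) * (pr c₄) + (pr c₃) * (1 - pr c₄) + (1 - pr c₃) * (pr c₄))) * prob pr (coreAvoidEvent arcs s t {p, q, a} {p, q, a})) ^ 2 * (((pr c₁) * (pr c₂) * (1 - pr c₃) * (1 - pr c₄)) * prob pr (coreAvoidEvent arcs s t {p, q, a} {p, q}) + ((pr c₁) * (pr c₂) * ((pr c₃) * (pr c₄) + (pr c₃) * (1 - pr c₄) + (1 - pr c₃) * (pr c₄))) * prob pr (coreAvoidEvent arcs s t {p, q, a} (insert w {p, q, a}))) - (((1 - pr c₁) * (1 - pr c₂) * ((pr c₃) + (1 - pr c₃)) * ((pr c₄) + (1 - pr c₄))) * prob pr (coreAvoidEvent arcs s t {p, q, a} ∅) + ((pr c₁) * (1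 - pr c₂) * (1 - pr c₃) * ((pr c₄) + (1 - pr c₄))) * prob pr (coreAvoidEvent arcs s t {p, q, a} {p}) + ((1 - pr c₁) * (pr c₂) * (1 - pr c₄) * ((pr c₃) + (1 - pr c₃))) * prob pr (coreAvoidEvent arcs s t {p, q, a} {q}) + ((pr c₁) * (pr c₂) * (1 - pr c₃) * (1 - pr c₄)) * prob pr (coreAvoidEvent arcs s t {p, q, a} {p, q}) + ((pr c₁) * (1 - pr c₂) * (pr c₃) * ((pr c₄) + (1 - pr c₄))) * prob pr (coreAvoidEvent arcs s t {p, q, a} {p, a}) + ((1 - pr c₁) * (pr c₂) * (pr c₄) * ((pr c₃) + (1 - pr c₃))) * prob pr (coreAvoidEvent arcs s t {p, q, a} {q, a}) + ((pr c₁) * (pr c₂) * ((pr c₃) * (pr c₄) + (pr c₃) * (1 - pr c₄) + (1 - pr c₃) * (pr c₄))) * prob pr (coreAvoidEvent arcs s t {p, q, a} {p, q, a})) * (((pr c₁) * (1 - pr c₂) * (1 - pr c₃) * ((pr c₄) + (1 - pr c₄))) * prob pr (coreAvoidEvent arcs s t {p, q, a} {p}) + ((pr c₁) * (pr c₂) *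 (1 - pr c₃) * (1 - pr c₄)) * prob pr (coreAvoidEvent arcs s t {p, q, a} {p, q}) + ((pr c₁) * (1 - pr c₂) * (pr c₃) * ((pr c₄) + (1 - pr c₄))) * prob pr (coreAvoidEvent arcs s t {p, q, a} {p, a}) + ((pr c₁) * (pr c₂) * ((pr c₃) * (pr c₄) + (pr c₃) * (1 - pr c₄) + (1 - pr c₃) * (pr c₄))) * prob pr (coreAvoidEvent arcs s t {p, q, a} {p, q, a})) * (((1 - pr c₁) * (pr c₂) * (1 - pr c₄) * ((pr c₃) + (1 - pr c₃))) * prob pr (coreAvoidEvent arcs s t {p, q, a} {q}) + ((pr c₁) * (pr c₂) * (1 - pr c₃) * (1 - pr c₄)) * prob pr (coreAvoidEvent arcs s t {p, q, a} {p, q}) + ((1 - pr c₁) * (pr c₂) * (pr c₄) * ((pr c₃) + (1 - pr c₃))) * prob pr (coreAvoidEvent arcs s t {p, q, a} (insert w {q, a})) + ((pr c₁) * (pr c₂) * ((pr c₃) * (pr c₄) + (pr c₃) * (1 - pr c₄) + (1 - pr c₃) * (pr c₄))) * prob pr (coreAvoidEvent arcs s t {p, q, a} (insert w {p, q, a})))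 - (((1 - pr c₁) * (1 - pr c₂) * ((pr c₃) + (1 - pr c₃)) * ((pr c₄) + (1 - pr c₄))) * prob pr (coreAvoidEvent arcs s t {p, q, a} ∅) + ((pr c₁) * (1 - pr c₂) * (1 - pr c₃) * ((pr c₄) + (1 - pr c₄))) * prob pr (coreAvoidEvent arcs s t {p, q, a} {p}) + ((1 - pr c₁) * (pr c₂) * (1 - pr c₄) * ((pr c₃) + (1 - pr c₃))) * prob pr (coreAvoidEvent arcs s t {p, q, a} {q}) + ((pr c₁) * (pr c₂) * (1 - pr c₃) * (1 - pr c₄)) * prob pr (coreAvoidEvent arcs s t {p, q, a} {p, q}) + ((pr c₁) * (1 - pr c₂) * (pr c₃) * ((pr c₄) + (1 - pr c₄))) * prob pr (coreAvoidEvent arcs s t {p, q, a} {p, a}) + ((1 - pr c₁) * (pr c₂) * (pr c₄) * ((pr c₃) + (1 - pr c₃))) * prob pr (coreAvoidEvent arcs s t {p, q, a} {q, a}) + ((pr c₁) * (pr c₂) * ((pr c₃) * (pr c₄) + (pr c₃) * (1 - pr c₄) + (1 - pr c₃) * (pr c₄))) * prob pr (coreAvoidEvent arcs s t {p, q, a}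 {p, q, a})) * (((1 - pr c₁) * (pr c₂) * (1 - pr c₄) * ((pr c₃) + (1 - pr c₃))) * prob pr (coreAvoidEvent arcs s t {p, q, a} {q}) + ((pr c₁) * (pr c₂) * (1 - pr c₃) * (1 - pr c₄)) * prob pr (coreAvoidEvent arcs s t {p, q, a} {p, q}) + ((1 - pr c₁) * (pr c₂) * (pr c₄) * ((pr c₃) + (1 - pr c₃))) * prob pr (coreAvoidEvent arcs s t {p, q, a} {q, a}) + ((pr c₁) * (pr c₂) * ((pr c₃) * (pr c₄) + (pr c₃) * (1 - pr c₄) + (1 - pr c₃) * (pr c₄))) * prob pr (coreAvoidEvent arcs s t {p, q, a} {p, q, a})) * (((pr c₁) * (1 - pr c₂) * (1 - pr c₃) * ((pr c₄) + (1 - pr c₄))) * prob pr (coreAvoidEvent arcs s t {p, q, a} {p}) + ((pr c₁) * (pr c₂) * (1 - pr c₃) * (1 - pr c₄)) * prob pr (coreAvoidEvent arcs s t {p, q, a} {p, q}) + ((pr c₁) * (1 - pr c₂) * (pr c₃) * ((pr c₄) + (1 - pr c₄))) * prob pr (coreAvoidEvent arcs s t {p, q, a} (insert w {p, a})) + ((pr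 c₁) * (pr c₂) * ((pr c₃) * (pr c₄) + (pr c₃) * (1 - pr c₄) + (1 - pr c₃) * (pr c₄))) * prob pr (coreAvoidEvent arcs s t {p, q, a} (insert w {p, q, a}))) + (((pr c₁) * (1 - pr c₂) * (1 - pr c₃) * ((pr c₄) + (1 - pr c₄))) * prob pr (coreAvoidEvent arcs s t {p, q, a} {p}) + ((pr c₁) * (pr c₂) * (1 - pr c₃) * (1 - pr c₄)) * prob pr (coreAvoidEvent arcs s t {p, q, a} {p, q}) + ((pr c₁) * (1 - pr c₂) * (pr c₃) * ((pr c₄) + (1 - pr c₄))) * prob pr (coreAvoidEvent arcs s t {p, q, a} {p, a}) + ((pr c₁) * (pr c₂) * ((pr c₃) * (pr c₄) + (pr c₃) * (1 - pr c₄) + (1 - pr c₃) * (pr c₄))) * prob pr (coreAvoidEvent arcs s t {p, q, a} {p, q, a})) * (((1 - pr c₁) * (pr c₂) * (1 - pr c₄) * ((pr c₃) + (1 - pr c₃))) * prob pr (coreAvoidEvent arcs s t {p, q, a} {q}) + ((pr c₁) * (pr c₂) * (1 - pr c₃) * (1 - pr c₄)) * prob pr (coreAvoidEvent arcs s t {p,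 q, a} {p, q}) + ((1 - pr c₁) * (pr c₂) * (pr c₄) * ((pr c₃) + (1 - pr c₃))) * prob pr (coreAvoidEvent arcs s t {p, q, a} {q, a}) + ((pr c₁) * (pr c₂) * ((pr c₃) * (pr c₄) + (pr c₃) * (1 - pr c₄) + (1 - pr c₃) * (pr c₄))) * prob pr (coreAvoidEvent arcs s t {p, q, a} {p, q, a})) * (((1 - pr c₁) * (1 - pr c₂) * ((pr c₃) + (1 - pr c₃)) * ((pr c₄) + (1 - pr c₄))) * prob pr (coreAvoidEvent arcs s t {p, q, a} ∅) + ((pr c₁) * (1 - pr c₂) * (1 - pr c₃) * ((pr c₄) + (1 - pr c₄))) * prob pr (coreAvoidEvent arcs s t {p, q, a} {p}) + ((1 - pr c₁) * (pr c₂) * (1 - pr c₄) * ((pr c₃) + (1 - pr c₃))) * prob pr (coreAvoidEvent arcs s t {p, q, a} {q}) + ((pr c₁) * (pr c₂) * (1 - pr c₃) * (1 - pr c₄)) * prob pr (coreAvoidEvent arcs s t {p, q, a} {p, q}) + ((pr c₁) * (1 - pr c₂) * (pr c₃) * ((pr c₄) + (1 - pr c₄))) * prob pr (coreAvoidEvent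 arcs s t {p, q, a} (insert w {p, a})) + ((1 - pr c₁) * (pr c₂) * (pr c₄) * ((pr c₃) + (1 - pr c₃))) * prob pr (coreAvoidEvent arcs s t {p, q, a} (insert w {q, a})) + ((pr c₁) * (pr c₂) * ((pr c₃) * (pr c₄) + (pr c₃) * (1 - pr c₄) + (1 - pr c₃) * (pr c₄))) * prob pr (coreAvoidEvent arcs s t {p, q, a} (insert w {p, q, a}))) := by
  have hpq := h.pq
  have hpa := h.pa
  have hqa := h.qa
  have hqp : q ≠ p := h.pq.symm
  have hap : a ≠ p := h.pa.symm
  have haq : a ≠ q := h.qa.symm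
  simp only [sum_powerset_three hpq hpa hqa, starTarget, Finset.mem_insert, Finset.mem_singleton,
    Finset.notMem_empty, hpq, hpa, hqa, hqp, hap, haq, h.nu_empty pr h12 h13 h14 h23 h24 h34, h.nu_p pr h12 h13 h14 h23 h24 h34, h.nu_q pr h12 h13 h14 h23 h24 h34, h.nu_pq pr h12 h13 h14 h23 h24 h34, h.nu_a pr h12 h13 h14 h23 h24 h34, h.nu_pa pr h12 h13 h14 h23 h24 h34, h.nu_qa pr h12 h13 h14 h23 h24 h34, h.nu_pqa pr h12 h13 h14 h23 h24 h34]
  simp only [or_self, or_false, or_true, if_true, if_false, mul_one, mul_zero, zero_mul, add_zero,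
    zero_add]
  ring

/-- **THEOREM (row 2′DARC over the directed diamond with the tail at the OR-vertex, every
head).**  Hypotheses: a mixed system (`SameEnds`), the diamond core with four distinct coins,
`t, w ∉ {s, p, q, a}`.  Conclusion: `Φ_D({s ↛ t in D + (a → w)}) ≥ 0` for the markers `p, q`.
No non-degeneracy hypothesis is needed: the certificate is a polynomial identity. -/
theorem darc_of_diamondCore (pr : E → R) (hp : IsProbVec pr) (hS : SameEnds arcs)
    (h : DiamondCore arcs s p q a c₁ c₂ c₃ c₄)
    (h12 : c₁ ≠ c₂) (h13 : c₁ ≠ c₃) (h14 : c₁ ≠ c₄) (h23 : c₂ ≠ c₃) (h24 : c₂ ≠ c₄) (h34 : c₃ ≠ c₄)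
    {t : V} (htC : t ∉ ({p, q, a} : Finset V)) (hts : t ≠ s) (hws : w ≠ s)
    (hwC : w ∉ ({p, q, a} : Finset V)) :
    DARC pr arcs s {t} p q a w := by
  have hC := h.closedInCoreU
  unfold DARC
  rw [hC.phiC_gate_eq pr hS htC hts (by simp) (by simp) (by simp) hws hwC,
    h.phi_sums_eq pr h12 h13 h14 h23 h24 h34 t]
  have hpq := h.pq
  have hpa := h.pa
  have hqa := h.qa
  have hqp : q ≠ p := h.pq.symm
  have hap : a ≠ p := h.pa.symm
  have haq : a ≠ q := h.qa.symm
  have hwp : w ≠ p := fun e => hwC (by simp [e])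
  have hwq : w ≠ q := fun e => hwC (by simp [e])
  have hwa : w ≠ a := fun e => hwC (by simp [e])
  set A : Finset V → R := fun X => prob pr (coreAvoidEvent arcs s t {p, q, a} X) with hA
  have hA0 : ∀ X, 0 ≤ A X := fun X => prob_nonneg hp _
  have hAmono : ∀ X Y : Finset V, X ⊆ Y → A Y ≤ A X := by
    intro X Y hXY
    simp only [hA]
    apply prob_mono hp
    intro ω hω v hv
    exact hω v (Finset.insert_subset_insert s hXY hv)
  have hAlsm : ∀ X Y : Finset V, A X * A Y ≤ A (X ∩ Y) * A (X ∪ Y) := by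
    intro X Y
    have hh := vdBKC_rev pr hp (sameEnds_coreOff (C := ({p, q, a} : Finset V)) hS) t ∅ ∅
      (insert s X) (insert s Y)
    have hi : insert s X ∩ insert s Y = insert s (X ∩ Y) := (Finset.insert_inter_distrib X Y s).symm
    have hun : insert s X ∪ insert s Y = insert s (X ∪ Y) := (Finset.insert_union_distrib s X Y).symm
    rw [hi, hun] at hh
    simp only [hA, coreAvoidEvent]
    simpa only [Finset.notMem_empty, false_imp_iff, implies_true, Set.setOf_true, Set.univ_inter,
      Finset.empty_union] using hh
  have hl : ∀ X Y Z U : Finset V, X ∩ Y = Z → X ∪ Y = U → A X * A Y ≤ A Z * A U := by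
    intro X Y Z U hZ hU
    rw [← hZ, ← hU]; exact hAlsm X Y
  have key := diamond_cert (pr c₁) (1 - pr c₁) (pr c₂) (1 - pr c₂) (pr c₃) (1 - pr c₃) (pr c₄)
    (1 - pr c₄) (A ∅) (A {p}) (A {q}) (A {p, q}) (A {p, a}) (A {q, a}) (A {p, q, a}) (A {a}) (A (insert w {p, a})) (A (insert w {q, a})) (A (insert w {p, q, a}))
    (hp.nonneg c₁) (sub_nonneg.2 (hp.le_one c₁)) (hp.nonneg c₂) (sub_nonneg.2 (hp.le_one c₂))
    (hp.nonneg c₃) (sub_nonneg.2 (hp.le_one c₃)) (hp.nonneg c₄) (sub_nonneg.2 (hp.le_one c₄))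
    (hA0 _) (hA0 _) (hA0 _) (hA0 _) (hA0 _) (hA0 _) (hA0 _) (hA0 _) (hA0 _) (hA0 _)
    (diamond_step1 A hl h hwC) (diamond_step2 A hl h hwC) (diamond_step3 A hl h hwC) (diamond_step4 A hl h hwC) (diamond_step5 A hl h hwC) (diamond_step6 A hl h hwC) (diamond_step7 A hl h hwC) (diamond_step8 A hl h hwC) (diamond_step9 A hl h hwC) (diamond_step10 A hl h hwC) (diamond_step11 A hl h hwC) (diamond_step12 A hAmono) (diamond_step13 A hAmono) (diamond_step14 A hAmono) (diamond_step15 A hAmono) (diamond_step16 A hAmono) (diamond_step17 A hAmono) (diamond_step18 A hAmono) (diamond_step19 A hAmono)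
  simpa only [hA] using key

end DiamondMain

end Summit.Ventures.PercRepro2.Coin
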